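import Summits.QuantumFields.YangMills.Theorems.SwapVirialDeficitZeroModeThreeColumns
import HarnessLib

/-!
# The `k = 3` zero-mode block is REGULAR, VI: ★★★ the POWER REMAINDER `|β²·Z₃(β) − A₃| ≤ K₃·β^{-1/4}`
# (free-hands support of crux ⟨stmt-QuantumFields-24197⟩ `SwapVirialDeficit.SwapGluedStiffness`, LINE «sharp-sigma» of planner seat ym-idea-4; companion of
# files I–V ✓`SwapVirialDeficitZeroModeThree{Scaling,Bound,NoLog,Lower,Columns}`)

Radial assembly of the symmetrised sandwich of file IV with the column integrals of file V: a.e. in the largest column `a` (`r = ‖a‖`),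
`w·∫k_∞ ≤ w·∫k_β + b_{β,ρ}(r)` with `w = e^{−r²/2}r⁻²` and the two-regime profile `b = w·4π²` (`r ≤ ρ`), `b = w·32π²(3r⁻⁴+r⁻²)/β` (`r > ρ`);
polar coordinates (`∫f(‖a‖)da = 3vol(B₁)∫r²f`, ✓`lintegral_radial`) and `∫_ρ^∞(3r⁻⁴+r⁻²)dr = ρ⁻³ + ρ⁻¹` give
★★ `A3_sub_le_radial`: `A₃ − β²Z₃(β) ≤ 9·vol(B₁)·(4π²ρ + 32π²(ρ⁻³+ρ⁻¹)/β)` for all `β, ρ > 0`, and with `ρ = β^{-1/4}`: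

★★★ `abs_sq_mul_zeroModeZ_three_sub_A3_le : 1 ≤ β → |β ^ 2 * zeroModeZ 3 β − A3| ≤ K3 * β ^ (-(1/4:ℝ))`

— the Gaussian-regularised commuting-TRIPLE block obeys the SHARP LAW WITH POWER REMAINDER `β²Z₃(β) = A₃(1 + O(β^{-1/4}))`: exponent `2`,
multiplicity `1`, correction exponent `θ = 1/4`, exactly the profile `m₃(t) = v t²(1 + O(t^{1/4}))` asserted for the σ zero-mode block by the LINE card
«sharp-sigma» (bc/g14-B/sigma) — here as a kernel theorem in the `ℝ³`-model (`zeroModeZ`), in the `|·/(v t^N) − 1| ≤ κ t^θ` shape that the line's Tauberian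
layer ✓`SharpSigma.tauber_sandwich_rpow` consumes.  The `β^{-1/4}` comes from the all-small region `‖a‖ ≲ β^{-1/4}` where the quartic is not yet in
its scaling regime (the same region that produces the logarithm at `k = 4`).

HONEST LABEL: a finite-dimensional Laplace asymptotic (plan-level zero-mode rung of a DRAFT line); it is NOT the fixed-`L` sharp small-ball law of the
σ-glued ring (`hvol` of ✓`swap_rung_fixedL_of_principalLaw`), NOT `SharpSwapVolumeLaw`; ⟨24197⟩, ⟨24194⟩ and every rung / summit statement stay OPEN;
the Yang–Mills mass gap is NOT proved; no summit is proved by a line.  Width seat ym-line-sfw-p2-w3 g62 (cell ym-idea-1, free hands; own crux ⟨22884⟩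
blocked-on ⟨19935⟩), `--supports stmt-QuantumFields-24197`.  Standard axioms, 0 `sorry`.  References: [cite: tHooft1979]; [cite: Vanbaal2001]; [folklore].
-/

set_option autoImplicit false

noncomputable section

namespace Summit.QuantumFields.YangMills.Theorems.ToronValleyVolume.ZeroMode

open MeasureTheory Real Finset Set Filter
open scoped ENNReal Topology
open Summit.QuantumFields.YangMills.Cruxes.ToronTubeVolumeLaw.Birth

/-! ## §17 The two-regime radial profile -/

/-- `C₀ = 4π²` (bound for `∫k_∞`) and `C₁ = 32π²` (gap constant). -/
def Czero : ℝ := 4 * Real.pi ^ 2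

/-- The gap constant `C₁ = 32π²`. -/
def Cone : ℝ := 32 * Real.pi ^ 2

/-- Auxiliary: `Czero_pos`. [folklore] -/
theorem Czero_pos : 0 < Czero := by unfold Czero; positivity

/-- Auxiliary: `Cone_pos`. [folklore] -/
theorem Cone_pos : 0 < Cone := by unfold Cone; positivity

/-- The two-regime radial profile `b_{β,ρ}(r) = e^{−r²/2}r⁻²·(C₀ if r ≤ ρ, else C₁(3r⁻⁴ + r⁻²)/β)`. -/
def bprof (β ρ r : ℝ) : ℝ≥0∞ :=
  ENNReal.ofReal (Real.exp (-r ^ 2 / 2) / r ^ 2) *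
    ENNReal.ofReal (if r ≤ ρ then Czero else Cone * (3 / r ^ 4 + 1 / r ^ 2) / β)

/-- Auxiliary: `measurable_bprof`. [folklore] -/
theorem measurable_bprof (β ρ : ℝ) : Measurable (bprof β ρ) := by
  unfold bprof
  refine (ENNReal.measurable_ofReal.comp (by fun_prop)).mul (ENNReal.measurable_ofReal.comp ?_)
  exact Measurable.ite measurableSet_Iic measurable_const (by fun_prop)

/-- ★ A.E. POINTWISE SANDWICH in the largest column: `w(a)·∫k_∞(‖a‖,·) ≤ w(a)·∫k_β(‖a‖,·) + b_{β,ρ}(‖a‖)` (`a ≠ 0`). [folklore] -/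
theorem weight_kup_le {β ρ : ℝ} (hβ : 0 < β) {a : EuclideanSpace ℝ (Fin 3)} (ha : a ≠ 0) :
    ENNReal.ofReal (Real.exp (-‖a‖ ^ 2 / 2) / ‖a‖ ^ 2) * ∫⁻ y, kup ‖a‖ y ≤
      ENNReal.ofReal (Real.exp (-‖a‖ ^ 2 / 2) / ‖a‖ ^ 2) * (∫⁻ y, klow β ‖a‖ y) + bprof β ρ ‖a‖ := by
  have hr : 0 < ‖a‖ := norm_pos_iff.2 ha
  unfold bprof
  by_cases hle : ‖a‖ ≤ ρ
  · rw [if_pos hle]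
    calc ENNReal.ofReal (Real.exp (-‖a‖ ^ 2 / 2) / ‖a‖ ^ 2) * ∫⁻ y, kup ‖a‖ y
        ≤ ENNReal.ofReal (Real.exp (-‖a‖ ^ 2 / 2) / ‖a‖ ^ 2) * ENNReal.ofReal Czero := by
          gcongr; exact lintegral_kup_le ‖a‖
      _ ≤ _ := le_add_self
  · rw [if_neg hle]
    have hsum : ∫⁻ y, kup ‖a‖ y ≤ (∫⁻ y, klow β ‖a‖ y) + ∫⁻ y, dgap β ‖a‖ y := by
      rw [← lintegral_add_left (measurable_klow β ‖a‖)]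
      exact lintegral_mono fun y => kup_le_klow_add_dgap hβ hr y
    calc ENNReal.ofReal (Real.exp (-‖a‖ ^ 2 / 2) / ‖a‖ ^ 2) * ∫⁻ y, kup ‖a‖ y
        ≤ ENNReal.ofReal (Real.exp (-‖a‖ ^ 2 / 2) / ‖a‖ ^ 2) * ((∫⁻ y, klow β ‖a‖ y) + ∫⁻ y, dgap β ‖a‖ y) := by gcongr
      _ ≤ ENNReal.ofReal (Real.exp (-‖a‖ ^ 2 / 2) / ‖a‖ ^ 2) * ((∫⁻ y, klow β ‖a‖ y) +
            ENNReal.ofReal (Cone * (3 / ‖a‖ ^ 4 + 1 / ‖a‖ ^ 2) / β)) := by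
          gcongr; unfold Cone; exact lintegral_dgap_le hβ hr
      _ = _ := by rw [mul_add]

/-- ★ RADIAL INTEGRAL of the profile: `∫_{r>0} r²·b_{β,ρ}(r) dr ≤ C₀ρ + (C₁/β)(ρ⁻³ + ρ⁻¹)` (`β, ρ > 0`). [folklore] -/
theorem lintegral_bprof_le {β ρ : ℝ} (hβ : 0 < β) (hρ : 0 < ρ) :
    ∫⁻ r in Ioi (0 : ℝ), ENNReal.ofReal (r ^ 2) * bprof β ρ r ≤
      ENNReal.ofReal (Czero * ρ + Cone / β * ((ρ ^ 3)⁻¹ + ρ⁻¹)) := by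
  set f₁ : ℝ → ℝ≥0∞ := (Ioc 0 ρ).indicator fun _ => ENNReal.ofReal Czero with hf₁
  set f₂ : ℝ → ℝ≥0∞ := (Ioi ρ).indicator fun r => ENNReal.ofReal (Cone / β * (3 * r ^ (-4 : ℝ) + r ^ (-2 : ℝ))) with hf₂
  have hm₁ : Measurable f₁ := measurable_const.indicator measurableSet_Ioc
  -- pointwise domination on `(0, ∞)`
  have hpt : ∀ r ∈ Ioi (0 : ℝ), ENNReal.ofReal (r ^ 2) * bprof β ρ r ≤ f₁ r + f₂ r := by
    intro r hr
    rw [Set.mem_Ioi] at hr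
    unfold bprof
    rw [← mul_assoc, ← ENNReal.ofReal_mul (sq_nonneg _),
      show r ^ 2 * (Real.exp (-r ^ 2 / 2) / r ^ 2) = Real.exp (-r ^ 2 / 2) by field_simp]
    have he : Real.exp (-r ^ 2 / 2) ≤ 1 := Real.exp_le_one_iff.2 (by nlinarith)
    by_cases h1 : r ≤ ρ
    · rw [if_pos h1]
      have : ENNReal.ofReal (Real.exp (-r ^ 2 / 2)) * ENNReal.ofReal Czero ≤ f₁ r := by
        rw [hf₁, indicator_of_mem (show r ∈ Ioc 0 ρ from ⟨hr, h1⟩), ← ENNReal.ofReal_mul (Real.exp_pos _).le]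
        exact ENNReal.ofReal_le_ofReal (by nlinarith [Czero_pos])
      exact this.trans le_self_add
    · rw [if_neg h1]
      push Not at h1
      have hpow : 3 / r ^ 4 + 1 / r ^ 2 = 3 * r ^ (-4 : ℝ) + r ^ (-2 : ℝ) := by
        rw [Real.rpow_neg hr.le, Real.rpow_neg hr.le, show (4 : ℝ) = ((4 : ℕ) : ℝ) by norm_num,
          show (2 : ℝ) = ((2 : ℕ) : ℝ) by norm_num, Real.rpow_natCast, Real.rpow_natCast]
        field_simp
      have : ENNReal.ofReal (Real.exp (-r ^ 2 / 2)) * ENNReal.ofReal (Cone * (3 / r ^ 4 + 1 / r ^ 2) / β) ≤ f₂ r := by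
        rw [hf₂, indicator_of_mem (show r ∈ Ioi ρ from h1), ← ENNReal.ofReal_mul (Real.exp_pos _).le, hpow]
        refine ENNReal.ofReal_le_ofReal ?_
        have hC : 0 ≤ Cone / β * (3 * r ^ (-4 : ℝ) + r ^ (-2 : ℝ)) := by
          have := Cone_pos; positivity
        rw [show Cone * (3 * r ^ (-4 : ℝ) + r ^ (-2 : ℝ)) / β = Cone / β * (3 * r ^ (-4 : ℝ) + r ^ (-2 : ℝ)) by ring]
        nlinarith
      exact this.trans le_add_self
  -- the two integrals
  have hI₁ : ∫⁻ r in Ioi (0 : ℝ), f₁ r ≤ ENNReal.ofReal (Czero * ρ) := by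
    calc ∫⁻ r in Ioi (0 : ℝ), f₁ r ≤ ∫⁻ r, f₁ r := setLIntegral_le_lintegral _ _
      _ = ENNReal.ofReal (Czero * ρ) := by
          rw [hf₁, lintegral_indicator measurableSet_Ioc, setLIntegral_const, Real.volume_Ioc, sub_zero,
            ← ENNReal.ofReal_mul Czero_pos.le]
  have hI₂ : ∫⁻ r in Ioi (0 : ℝ), f₂ r ≤ ENNReal.ofReal (Cone / β * ((ρ ^ 3)⁻¹ + ρ⁻¹)) := by
    have hint4 : IntegrableOn (fun r : ℝ => r ^ (-4 : ℝ)) (Ioi ρ) := integrableOn_Ioi_rpow_of_lt (by norm_num) hρ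
    have hint2 : IntegrableOn (fun r : ℝ => r ^ (-2 : ℝ)) (Ioi ρ) := integrableOn_Ioi_rpow_of_lt (by norm_num) hρ
    have hint : IntegrableOn (fun r : ℝ => Cone / β * (3 * r ^ (-4 : ℝ) + r ^ (-2 : ℝ))) (Ioi ρ) :=
      ((hint4.const_mul 3).add hint2).const_mul _
    calc ∫⁻ r in Ioi (0 : ℝ), f₂ r ≤ ∫⁻ r, f₂ r := setLIntegral_le_lintegral _ _
      _ = ∫⁻ r in Ioi ρ, ENNReal.ofReal (Cone / β * (3 * r ^ (-4 : ℝ) + r ^ (-2 : ℝ))) := by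
          rw [hf₂, lintegral_indicator measurableSet_Ioi]
      _ = ENNReal.ofReal (∫ r in Ioi ρ, Cone / β * (3 * r ^ (-4 : ℝ) + r ^ (-2 : ℝ))) := by
          rw [← ofReal_integral_eq_lintegral_ofReal hint]
          exact (ae_restrict_iff' measurableSet_Ioi).2 (Filter.Eventually.of_forall fun r hr => by
            have : 0 < r := hρ.trans hr
            have := Cone_pos
            positivity)
      _ = ENNReal.ofReal (Cone / β * ((ρ ^ 3)⁻¹ + ρ⁻¹)) := by
          congr 1
          rw [integral_const_mul, integral_add (hint4.const_mul 3) hint2, integral_const_mul,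
            integral_Ioi_rpow_of_lt (by norm_num) hρ, integral_Ioi_rpow_of_lt (by norm_num) hρ]
          have h3 : ρ ^ ((-4 : ℝ) + 1) = (ρ ^ 3)⁻¹ := by
            rw [show (-4 : ℝ) + 1 = -3 by norm_num, Real.rpow_neg hρ.le, show (3 : ℝ) = ((3 : ℕ) : ℝ) by norm_num,
              Real.rpow_natCast]
          have h1 : ρ ^ ((-2 : ℝ) + 1) = ρ⁻¹ := by
            rw [show (-2 : ℝ) + 1 = -1 by norm_num, Real.rpow_neg_one]
          rw [h3, h1]
          ring
  calc ∫⁻ r in Ioi (0 : ℝ), ENNReal.ofReal (r ^ 2) * bprof β ρ r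
      ≤ ∫⁻ r in Ioi (0 : ℝ), (f₁ r + f₂ r) := setLIntegral_mono' measurableSet_Ioi hpt
    _ = (∫⁻ r in Ioi (0 : ℝ), f₁ r) + ∫⁻ r in Ioi (0 : ℝ), f₂ r := lintegral_add_left hm₁ _
    _ ≤ ENNReal.ofReal (Czero * ρ) + ENNReal.ofReal (Cone / β * ((ρ ^ 3)⁻¹ + ρ⁻¹)) := add_le_add hI₁ hI₂
    _ = ENNReal.ofReal (Czero * ρ + Cone / β * ((ρ ^ 3)⁻¹ + ρ⁻¹)) := by
        rw [← ENNReal.ofReal_add (by have := Czero_pos; positivity) (by have := Cone_pos; positivity)]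

/-! ## §18 The remainder -/

/-- The volume of the unit ball of `ℝ³` (as a real number). -/
def volB : ℝ := (volume (Metric.ball (0 : EuclideanSpace ℝ (Fin 3)) 1)).toReal

/-- Auxiliary: `volB_nonneg`. [folklore] -/
theorem volB_nonneg : 0 ≤ volB := ENNReal.toReal_nonneg

/-- ★★ **RADIAL REMAINDER BOUND**: `A₃ − β²·Z₃(β) ≤ 9·vol(B₁)·(C₀ρ + (C₁/β)(ρ⁻³ + ρ⁻¹))` for all `β, ρ > 0`. [folklore] -/
theorem A3_sub_le_radial {β ρ : ℝ} (hβ : 0 < β) (hρ : 0 < ρ) :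
    A3 - β ^ 2 * zeroModeZ 3 β ≤ 9 * volB * (Czero * ρ + Cone / β * ((ρ ^ 3)⁻¹ + ρ⁻¹)) := by
  have hae : ∀ᵐ a : EuclideanSpace ℝ (Fin 3) ∂volume, a ≠ 0 := ae_iff.2 (by simp)
  -- `L₃ ≤ β²Z₃(β) + 3·∫ b(‖a‖) da`
  have hL : L3 ≤ ENNReal.ofReal (β ^ 2 * zeroModeZ 3 β) + 3 * ∫⁻ a : EuclideanSpace ℝ (Fin 3), bprof β ρ ‖a‖ := by
    have hmb : Measurable fun a : EuclideanSpace ℝ (Fin 3) => bprof β ρ ‖a‖ := (measurable_bprof β ρ).comp measurable_norm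
    calc L3 ≤ 3 * ∫⁻ a : EuclideanSpace ℝ (Fin 3), (ENNReal.ofReal (Real.exp (-‖a‖ ^ 2 / 2) / ‖a‖ ^ 2) * (∫⁻ y, klow β ‖a‖ y)
          + bprof β ρ ‖a‖) := by
          unfold L3; gcongr 3 * ?_
          exact lintegral_mono_ae (by filter_upwards [hae] with a ha using weight_kup_le (ρ := ρ) hβ ha)
      _ = 3 * (∫⁻ a : EuclideanSpace ℝ (Fin 3), ENNReal.ofReal (Real.exp (-‖a‖ ^ 2 / 2) / ‖a‖ ^ 2) * ∫⁻ y, klow β ‖a‖ y)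
          + 3 * ∫⁻ a : EuclideanSpace ℝ (Fin 3), bprof β ρ ‖a‖ := by
          rw [lintegral_add_right _ hmb, mul_add]
      _ ≤ _ := by gcongr; exact three_lintegral_klow_le hβ
  -- the radial integral of `b`
  have hrad : ∫⁻ a : EuclideanSpace ℝ (Fin 3), bprof β ρ ‖a‖ ≤
      3 * volume (Metric.ball (0 : EuclideanSpace ℝ (Fin 3)) 1) * ENNReal.ofReal (Czero * ρ + Cone / β * ((ρ ^ 3)⁻¹ + ρ⁻¹)) := by
    rw [show (fun a : EuclideanSpace ℝ (Fin 3) => bprof β ρ ‖a‖) = fun a => (bprof β ρ) ‖a‖ from rfl,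
      lintegral_radial _ (measurable_bprof β ρ)]
    gcongr
    exact lintegral_bprof_le hβ hρ
  have hvol : volume (Metric.ball (0 : EuclideanSpace ℝ (Fin 3)) 1) ≠ ⊤ := measure_ball_lt_top.ne
  have hR0 : 0 ≤ Czero * ρ + Cone / β * ((ρ ^ 3)⁻¹ + ρ⁻¹) := by have := Czero_pos; have := Cone_pos; positivity
  -- combine in `ℝ≥0∞`, then pass to `ℝ`
  have hfin : ENNReal.ofReal A3 ≤ ENNReal.ofReal (β ^ 2 * zeroModeZ 3 β) +
      ENNReal.ofReal (9 * volB * (Czero * ρ + Cone / β * ((ρ ^ 3)⁻¹ + ρ⁻¹))) := by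
    calc ENNReal.ofReal A3 ≤ L3 := ofReal_A3_le_L3
      _ ≤ ENNReal.ofReal (β ^ 2 * zeroModeZ 3 β) + 3 * ∫⁻ a : EuclideanSpace ℝ (Fin 3), bprof β ρ ‖a‖ := hL
      _ ≤ ENNReal.ofReal (β ^ 2 * zeroModeZ 3 β) + 3 * (3 * volume (Metric.ball (0 : EuclideanSpace ℝ (Fin 3)) 1) *
            ENNReal.ofReal (Czero * ρ + Cone / β * ((ρ ^ 3)⁻¹ + ρ⁻¹))) := by gcongr
      _ = ENNReal.ofReal (β ^ 2 * zeroModeZ 3 β) +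
            ENNReal.ofReal (9 * volB * (Czero * ρ + Cone / β * ((ρ ^ 3)⁻¹ + ρ⁻¹))) := by
          congr 1
          unfold volB
          rw [ENNReal.ofReal_mul (mul_nonneg (by norm_num) ENNReal.toReal_nonneg), ENNReal.ofReal_mul (by norm_num),
            ENNReal.ofReal_toReal hvol]
          rw [show (9 : ℝ) = 3 * 3 by norm_num, ENNReal.ofReal_mul (by norm_num), ENNReal.ofReal_ofNat]
          ring
  have hK : 0 ≤ 9 * volB * (Czero * ρ + Cone / β * ((ρ ^ 3)⁻¹ + ρ⁻¹)) :=
    mul_nonneg (mul_nonneg (by norm_num) volB_nonneg) hR0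
  have hZ : 0 ≤ β ^ 2 * zeroModeZ 3 β := mul_nonneg (sq_nonneg _) (zeroModeZ_nonneg 3 β)
  rw [← ENNReal.ofReal_add hZ hK] at hfin
  have := (ENNReal.ofReal_le_ofReal_iff (add_nonneg hZ hK)).1 hfin
  linarith

/-- THE REMAINDER CONSTANT `K₃ = 9·vol(B₁)·(C₀ + 2C₁) = 9·vol(B₁)·68π²`. -/
def K3 : ℝ := 9 * volB * (Czero + 2 * Cone)

/-- Auxiliary: `K3_nonneg`. [folklore] -/
theorem K3_nonneg : 0 ≤ K3 := by
  unfold K3; have := Czero_pos; have := Cone_pos; have := volB_nonneg; positivity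

/-- ★★ **ONE-SIDED POWER REMAINDER**: `A₃ − β²·Z₃(β) ≤ K₃·β^{-1/4}` for `β ≥ 1` (choose `ρ = β^{-1/4}`). [folklore] -/
theorem A3_sub_le {β : ℝ} (hβ : 1 ≤ β) : A3 - β ^ 2 * zeroModeZ 3 β ≤ K3 * β ^ (-(1 / 4 : ℝ)) := by
  have hβ0 : 0 < β := by linarith
  set ρ : ℝ := β ^ (-(1 / 4 : ℝ)) with hρdef
  have hρ : 0 < ρ := Real.rpow_pos_of_pos hβ0 _
  have h := A3_sub_le_radial hβ0 hρ
  -- `ρ⁻¹ = β^{1/4}`, `ρ⁻³ = β^{3/4}`, and `β^{3/4}/β = β^{-1/4}`, `β^{1/4}/β = β^{-3/4} ≤ β^{-1/4}`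
  have hinv : ρ⁻¹ = β ^ (1 / 4 : ℝ) := by rw [hρdef, Real.rpow_neg hβ0.le, inv_inv]
  have hinv3 : (ρ ^ 3)⁻¹ = β ^ (3 / 4 : ℝ) := by
    rw [hρdef, ← Real.rpow_natCast, ← Real.rpow_mul hβ0.le, ← Real.rpow_neg hβ0.le]
    norm_num
  have hA : Cone / β * ((ρ ^ 3)⁻¹ + ρ⁻¹) = Cone * (β ^ (-(1 / 4 : ℝ)) + β ^ (-(3 / 4 : ℝ))) := by
    rw [hinv, hinv3, div_mul_eq_mul_div, mul_div_assoc]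
    congr 1
    rw [add_div, show β ^ (3 / 4 : ℝ) / β = β ^ (3 / 4 : ℝ) * β ^ (-1 : ℝ) by rw [Real.rpow_neg_one, div_eq_mul_inv],
      show β ^ (1 / 4 : ℝ) / β = β ^ (1 / 4 : ℝ) * β ^ (-1 : ℝ) by rw [Real.rpow_neg_one, div_eq_mul_inv],
      ← Real.rpow_add hβ0, ← Real.rpow_add hβ0]
    norm_num
  have hmono : β ^ (-(3 / 4 : ℝ)) ≤ β ^ (-(1 / 4 : ℝ)) := Real.rpow_le_rpow_of_exponent_le hβ (by norm_num)
  have hC := Cone_pos; have hC0 := Czero_pos; have hV := volB_nonneg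
  calc A3 - β ^ 2 * zeroModeZ 3 β ≤ 9 * volB * (Czero * ρ + Cone / β * ((ρ ^ 3)⁻¹ + ρ⁻¹)) := h
    _ = 9 * volB * (Czero * β ^ (-(1 / 4 : ℝ)) + Cone * (β ^ (-(1 / 4 : ℝ)) + β ^ (-(3 / 4 : ℝ)))) := by rw [hA]
    _ ≤ 9 * volB * (Czero * β ^ (-(1 / 4 : ℝ)) + Cone * (β ^ (-(1 / 4 : ℝ)) + β ^ (-(1 / 4 : ℝ)))) := by gcongr
    _ = K3 * β ^ (-(1 / 4 : ℝ)) := by unfold K3; ring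

/-- ★★★ **THE SHARP LAW OF THE `k = 3` ZERO-MODE BLOCK WITH POWER REMAINDER**:
`|β²·Z₃(β) − A₃| ≤ K₃·β^{-1/4}` for every `β ≥ 1` — exponent `2`, multiplicity `1` (NO log), correction exponent `θ = 1/4`. [folklore] -/
theorem abs_sq_mul_zeroModeZ_three_sub_A3_le {β : ℝ} (hβ : 1 ≤ β) :
    |β ^ 2 * zeroModeZ 3 β - A3| ≤ K3 * β ^ (-(1 / 4 : ℝ)) := by
  have h1 := A3_sub_le hβ
  have h2 := sq_mul_zeroModeZ_three_le_A3 (show (0 : ℝ) < β by linarith)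
  rw [abs_sub_comm, abs_of_nonneg (by linarith)]
  exact h1

/-- ★★★ **RELATIVE FORM** (the `|m/(v t^N) − 1| ≤ κ t^θ` shape of the line's Tauberian layer): `|β²·Z₃(β)/A₃ − 1| ≤ (K₃/A₃)·β^{-1/4}`, `β ≥ 1`.
[folklore] -/
theorem abs_sq_mul_zeroModeZ_three_div_A3_sub_one_le {β : ℝ} (hβ : 1 ≤ β) :
    |β ^ 2 * zeroModeZ 3 β / A3 - 1| ≤ K3 / A3 * β ^ (-(1 / 4 : ℝ)) := by
  have hA := A3_pos
  rw [show β ^ 2 * zeroModeZ 3 β / A3 - 1 = (β ^ 2 * zeroModeZ 3 β - A3) / A3 by field_simp, abs_div, abs_of_pos hA,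
    div_le_iff₀ hA, show K3 / A3 * β ^ (-(1 / 4 : ℝ)) * A3 = K3 * β ^ (-(1 / 4 : ℝ)) by field_simp]
  exact abs_sq_mul_zeroModeZ_three_sub_A3_le hβ

/-- ★★★ **PACKAGED**: `∃ A > 0, ∃ K, ∀ β ≥ 1, |β²·Z₃(β) − A| ≤ K·β^{-1/4}` — the σ-sector zero-mode block (commuting triples) has a sharp pure power law
with a `β^{-1/4}` remainder; compare the periodic `k = 4` block ✓`stub_rung_zeroModeLog4` (`β³Z₄/log β → A`, one log). [folklore] -/
theorem zeroModeZ_three_sharp :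
    ∃ A K : ℝ, 0 < A ∧ 0 ≤ K ∧ ∀ β : ℝ, 1 ≤ β → |β ^ 2 * zeroModeZ 3 β - A| ≤ K * β ^ (-(1 / 4 : ℝ)) :=
  ⟨A3, K3, A3_pos, K3_nonneg, fun _ hβ => abs_sq_mul_zeroModeZ_three_sub_A3_le hβ⟩

end Summit.QuantumFields.YangMills.Theorems.ToronValleyVolume.ZeroMode

end
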